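import Mathlib
import Summits.Ventures.PercRepro2.HCov

/-!
# Candidate row (HMF2): `G ≥ 2·H_T` (blind cell PercRepro2, typer-1; mine-a g3 MINE-A.md §17 "the
Rao–Blackwell family of (HCOV)", lead g11 13:50:52Z "(HMF2) := G ≥ 2·H_T is a CANDIDATE ROW
(stronger than the crux, admits the (A,B)-frame)"; census n = 5 FULL 7,560 + n = 6 3,296, 0 violations)

In the two-stage frame `𝓖 = σ(C(a₃), C(a_h))`, the law of total covariance gives
`G/P(Q) = G_𝓖 + E_μ[J_𝓖]` with `J_𝓖 = 2·1_T·Cov_{G−A}(f_b, f_o) ≥ 0` (Harris), so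
`(HMF2) := G_𝓖 ≥ 0 ⟺ G ≥ 2·H_T`,

`H_T := Σ_{A ∋ a_h, a_l ∉ A} P(C(a₃) = A) · Cov_{G−A}(1[b ↔ a_l], 1[o ↔ a_l])`

(the T-type Harris slack of the frame: the covariance, under the product law on `G − A`, of the
two connections of `b`, `o` to the light root). Here `a_l = a₁`, `a_h = a₂` in `CovForm.Gc`'s
labelling, and `Cov_{G−A}` is the covariance of the `delConfig`-connection events.

* `delConn ends A x v = {x ↔ v in G − A}`; `covDel p ends A x b o` its covariance;
* **`HT`** `= Σ_{A : Set V} [a₂ ∈ A ∧ a₁ ∉ A] · P(C(a₃) = A) · covDel p ends A a₁ b o`;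
* **`HMF2`** `:= 0 ≤ Gc − 2 · D · P(Q) · H_T` (the cleared form of `G ≥ 2 H_T`, `Gc = D · P(Q) · G`);
  closure `HMF2_all`;
* **`HCov_of_HMF2`**: (HMF2) ⟹ (HCOV), since `H_T ≥ 0` (each `Cov_{G−A}` is a Harris covariance
  of two increasing events; the chain (HMF) ⟹ (HMF2) ⟹ (HCOV) of §17 is otherwise not formalised).
-/

namespace Summit.Ventures.PercRepro2

namespace CovForm

open scoped Classical

variable {V : Type*} {E : Type*} [Fintype E] [DecidableEq E] [Fintype V] [DecidableEq V]
  {R : Type*} [Field R] [LinearOrder R]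

section Defs

variable (p : E → R) (ends : E → Sym2 V)

/-- The connection `{x ↔ v in G − A}` (edges at `A` deleted). -/
def delConn (A : Set V) (x v : V) : Set (Config E) := {ω | Conn ends (delConfig ends A ω) x v}

/-- `Cov_{G−A}(1[b ↔ x], 1[o ↔ x])` under the product law. -/
noncomputable def covDel (A : Set V) (x b o : V) : R :=
  prob p (delConn ends A x b ∩ delConn ends A x o) -
    prob p (delConn ends A x b) * prob p (delConn ends A x o)

/-- **`H_T`** (mine-a §17): `Σ_{A ∋ a₂, a₁ ∉ A} P(C(a₃) = A) · Cov_{G−A}(1[b ↔ a₁], 1[o ↔ a₁])`. -/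
noncomputable def HT (o a₁ a₂ a₃ b : V) : R :=
  ∑ A : Set V, if a₂ ∈ A ∧ a₁ ∉ A then
    prob p (clusterEvent ends a₃ A) * covDel p ends A a₁ b o else 0

/-- **(HMF2)** (mine-a §17, lead 13:50:52Z): `G ≥ 2·H_T`, cleared by `D · P(Q)`:
`0 ≤ Gc − 2 · D · P(Q) · H_T`. -/
def HMF2 (o a₁ a₂ a₃ b : V) : Prop :=
  0 ≤ Gc p ends o a₁ a₂ a₃ b -
    2 * prob p (PDEvent ends a₁ a₂ a₃) * prob p (avoidAll ends a₂ {a₁}) * HT p ends o a₁ a₂ a₃ b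

end Defs

section Closure

variable (R : Type*) [Field R] [LinearOrder R] [IsStrictOrderedRing R]

/-- **(HMF2) for every finite graph** (the marking hypotheses of `HCov_all`). -/
def HMF2_all : Prop :=
  ∀ (V E : Type) [Fintype V] [DecidableEq V] [Fintype E] [DecidableEq E]
    (ends : E → Sym2 V) (p : E → R), IsProbVec p →
    ∀ o a₁ a₂ a₃ b : V, a₁ ≠ a₂ → a₁ ≠ a₃ → a₂ ≠ a₃ → o ≠ a₁ → o ≠ a₂ → o ≠ a₃ → o ≠ b →
      b ≠ a₁ → b ≠ a₂ → b ≠ a₃ → HMF2 p ends o a₁ a₂ a₃ b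

end Closure

/-! ## (HMF2) ⟹ (HCOV): `H_T ≥ 0` by Harris -/

section Reduction

variable [IsStrictOrderedRing R] (p : E → R) (ends : E → Sym2 V)

omit [Fintype E] [DecidableEq E] [Fintype V] [DecidableEq V] [Field R] [LinearOrder R]
  [IsStrictOrderedRing R] in
/-- `G − A` is monotone in the configuration. -/
lemma delConfig_mono (A : Set V) {ω ω' : Config E} (h : ω ≤ ω') :
    delConfig ends A ω ≤ delConfig ends A ω' := by
  intro e'
  by_cases he : e' ∈ touches ends A
  · rw [delConfig_apply_of_mem he]; exact Bool.false_le _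
  · rw [delConfig_apply_of_notMem he, delConfig_apply_of_notMem he]; exact h e'

omit [Fintype E] [DecidableEq E] [Fintype V] [DecidableEq V] [Field R] [LinearOrder R]
  [IsStrictOrderedRing R] in
/-- The connections of `G − A` are increasing events. -/
lemma isUpperSet_delConn (A : Set V) (x v : V) : IsUpperSet (delConn ends A x v) :=
  fun _ _ hle hω => conn_mono (delConfig_mono ends A hle) hω

omit [Fintype V] [DecidableEq V] in
/-- `Cov_{G−A}(1[b ↔ x], 1[o ↔ x]) ≥ 0` (Harris on `G − A`). -/
lemma covDel_nonneg (hp : IsProbVec p) (A : Set V) (x b o : V) : 0 ≤ covDel p ends A x b o := by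
  unfold covDel
  rw [sub_nonneg]
  exact prob_mul_prob_le_prob_inter hp (isUpperSet_delConn ends A x b) (isUpperSet_delConn ends A x o)

omit [DecidableEq V] in
/-- `H_T ≥ 0`. -/
lemma HT_nonneg (hp : IsProbVec p) (o a₁ a₂ a₃ b : V) : 0 ≤ HT p ends o a₁ a₂ a₃ b := by
  refine Finset.sum_nonneg fun A _ => ?_
  split_ifs
  · exact mul_nonneg (prob_nonneg hp _) (covDel_nonneg p ends hp A a₁ b o)
  · exact le_rfl

omit [DecidableEq V] in
/-- **(HMF2) ⟹ (HCOV)**: `G ≥ 2 H_T ≥ 0`. -/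
theorem HCov_of_HMF2 (hp : IsProbVec p) (o a₁ a₂ a₃ b : V) (h : HMF2 p ends o a₁ a₂ a₃ b) :
    HCov p ends o a₁ a₂ a₃ b := by
  unfold HCov
  unfold HMF2 at h
  have h2 : 0 ≤ 2 * prob p (PDEvent ends a₁ a₂ a₃) * prob p (avoidAll ends a₂ {a₁}) *
      HT p ends o a₁ a₂ a₃ b :=
    mul_nonneg (mul_nonneg (mul_nonneg (by norm_num) (prob_nonneg hp _)) (prob_nonneg hp _))
      (HT_nonneg p ends hp o a₁ a₂ a₃ b)
  linarith

end Reduction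

end CovForm

end Summit.Ventures.PercRepro2
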